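import Summits.QuantumFields.YangMills.Theorems.BalabanUVNodesN27AtRecord13CoPH
import Summits.QuantumFields.YangMills.Theorems.BalabanUVNodesN27AtRecord13CoPHHome
import Summits.QuantumFields.YangMills.Theorems.BalabanUVNodesRateCarriersOfRecord13CoPHOn

/-!
# BalabanUVNodes ∕ N27 = binder B5 AT THE RECORD, XXXIXᶜᵒᴾᴴ — N27 AT THE REGIME-RESTRICTED CoPH-KEYED STAGE-13 CARRIER HOMES: B5 from the one-application stub instances at
# `YMDAG.UVSplit.SRec₁₃CoPHOn cr Rg` (`…SpineCarriersOfRecord13CoPH` §4) and `YMDAG.UVSplit.RRec₁₃CoPHOn 𝔯 Rg` (dag-n22-e 5″ᶜᵒᴾᴴ `…RateCarriersOfRecord13CoPHOn`) — both READ AT THE TUPLE θ, restricted to an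
# arbitrary regime `Rg F θ` — with the SAME-TUPLE all-run-lengths N19′ edge, landing in RR-2's `Node00.IsRecordOfRecord₁₃CCoPHOn F N Rg` ∕ `…CCoPHN`: THE v1.7 `CoPH` EDITION OF MODULE XXXIX
# `…N27AtRecord13HomeOn` (p495062 ‴ ∕ p509851 ⁗); regime-generic, record-class-generic
# (cell `pub-ymgap`, HUMAN RULING D-0062 Track A, R134 seat `pub-ymgap-dag-n27-c` (s2) gen 9; `--kind proof --supports <K3 id of record> --as helper`; COUNT-NEUTRAL; `N`-generic, NO Theses import)

WHY THIS EDITION (v1.7 `CoPH` = RECORD 13 WITH THE HISTORY-INDEXED RESIDUAL 𝐓-WEIGHT SLOT `Zh p n Ω Λ` (+ the history-indexed §2 smearing `Phih`) — FINDING №9, director-ym №183 H1ʰ ∕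
№186 DESIGN (α) WHOLE-HISTORY ∕ №190 PRESS WORD; def-T FILE 27 `Node00/Record13CoPH.lean` p537939 ✓ + 28T `Node00/Record13SepCoPH.lean` p539169 ✓, RR-2 `Node00/Record13DatumKeyCoPH.lean` ∕
`…KeySepCoPH.lean` ✓ (guard `unityNondeg₁₃H`); route rev 24∕25, dag-lead WORDS-143: K3⁷ `SpineGivenEndpointR13SepCoPH` = stmt-QuantumFields-20544, the ⁶ items aside): this file is the T₇ image of my v1.6
storey `…N27AtRecord13CoPRHomeOn (XXXIXᶜᵒᴾᴿ)` (p536852 ✓), which STANDS as a landed sibling — binder `θ : Node00.Stage13RParams F N ↦ θ : Node00.Stage13HParams F N` (`extends Stage13RParams` by the fields `Zh`, `Phih`),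
core provisos `θ.Provisos₁₃CoPR ↦ θ.Provisos₁₃CoPH` (rows `zhLaws ∕ zhLocal`), datum ∕ tower ∕ record ∕ shadow ∕ faces `…₁₃CoPR ↦ …₁₃CoPH` (`datumOfRecord₁₃CoPH θ h` reads the history's
𝐓-weights `WtOfRecord₁₃H θ p s`), guard `θ.ZrUnity ↦ θ.ZhUnity` (RR-2 `unityNondeg₁₃R ↦ unityNondeg₁₃H`), RR-2's ∕ the carriers' ∕ my stems `CoPR ↦ CoPH`; the two SITE-RULE sites of the v1.6
image (`u3OfRecord₁₃ θ.toStage13Params`, the θ-level junction `n18At_u3OfRecord₁₃_readingAdm_iff θ.toStage13Params`) are UNCHANGED — `θ.toStage13Params`, `θ.γ`, `θ.τ9`, `θ.Admissible`,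
`θ.SlotsNondegenerate₁₃`, `θ.toStage12Params` resolve through the two-level `extends`.  bg-BLIND and proviso-FIELD-blind as before: the provisos enter ONLY as the binder type
`hc : θ.Provisos₁₃CoPH F N` and inside `datumOfRecord₁₃CoPH F N θ hc` (keyed ONCE; the item edition's tuple `(θ, h : θ.Provisos₁₃SepCoPH F N)` applies it at `hc := h.toCore`, datum `rfl` by
def-T's `datumOfRecord₁₃SepCoPH_eq_coPH`).  Statements AND proofs = the v1.6 module's, token for token under T₇; NO bridge to ∕ from the v1.6 storeys is stated (different data: `Zh p n Ω Λ`
per history vs `Zr p` per run; the ONE-WAY door ⁶ → ⁷ is def-T's `Stage13HParams.ofHistoryBlind`).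

WHY (as at Stage 12, dag-ref-H XXVII-PRE-READ-NOTE): module XXXVIIIᶜᵒᴾᴴ knits B5 at the CANONICALLY keyed homes `SRec₁₃CoPH cr` ∕ `RRec₁₃CoPH 𝔯` — its N19′ edge reads the rate bundle at `h.params
:= Classical.choose h`, and the item's guard on θ does NOT reach `h.params`; the honest shape is «state the rate stubs with the guard INSIDE and read them AT θ» = the TUPLE-keyed,
REGIME-restricted predicates `SRec₁₃CoPHOn cr Rg` ∕ `RRec₁₃CoPHOn 𝔯 Rg` with their guarded θ-form faces.  A bundle pinned by `SRec₁₃CoPHOn cr Rg` at `D` is `cr F θ hP g₀ os` for a tuple θ IN THE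
REGIME realising `D`, and K4's ∀-hook `RateInputsAll (RRec₁₃CoPHOn 𝔯 Rg) F D g₀ os` delivers the six rates at every run length of the rate reading AT THAT SAME θ (`rRec₁₃CoPHOn_self`); so XII
`spine_of_coreEdge` needs only the SAME-TUPLE edge, no pair of tuples, no `Classical.choose`, and — with the ∀-hook (`SpineRates_of_forall`) — no existence stub.

WHAT IS KERNEL-CHECKED ([bookkeeping]; 0 `def`, 0 `sorry`; every stub ∕ face ∕ edge a HYPOTHESIS — 0∕1 at every record today).
* §0 `sRec₁₃CoPHOn_iff_bundled` — (T-SPINE)'s regime home IS XXIV's characterised spine record at the BUNDLED key `Adm' θ := Rg F θ ∧ θ.Admissible F N`.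
* §1 `coreEdge_of_homes₁₃CoPHOn` — the edge XII consumes at `(SRec₁₃CoPHOn cr Rg, Inputs := RateInputsAll (RRec₁₃CoPHOn 𝔯 Rg))` from the same-tuple all-run-lengths guarded edge `h19`;
  `spineRates_rRec₁₃CoPHOn_of_keyedRates` — K4's ∀-hook at the regime home from the guarded θ-form of the six rates (any record class).
* §2 `spine_of_homes₁₃CoPHOn` — for ANY record class `Rec`: the six K4 stubs at `RRec₁₃CoPHOn 𝔯 Rg` · `S_N27x Rec (SRec₁₃CoPHOn cr Rg)` · `S_N20`, `S_N21` at `SRec₁₃CoPHOn cr Rg` · `h19` ⇒ `Spine Rec`;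
  `spine_of_homes₁₃CoPHOn_faces` — the same with the rates and N20∕N21 in guarded θ-form.
* §3 the regime-keyed datum class `fun F D _ => ∃ θ h, (Rg F θ ∧ θ.Admissible F N) ∧ D = datumOfRecord₁₃CoPH F N θ h`: `s_N27x_recOn₁₃CoPH_of_keyed` · **`forall_guarded₁₃CoPH_of_homes₁₃CoPHOn`** —
  «∀ F θ hP, Rg F θ → θ.Admissible F N → HybridNE7Under (datumOfRecord₁₃CoPH F N θ hP) END» from the stubs at the two regime homes, the guarded keyed extraction clause and `h19` (XXIVb
  `spine_keyedClass_iff_forall_keyed`) — THE GUARD REACHES EVERY HYPOTHESIS · `forall_guarded₁₃CoPH_of_homes₁₃CoPHOn_faces` (all θ-forms).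
* §4 `spine_rec13CCoPH_of_homes₁₃CoPHOn_true` — the trivial regime and `Rec := Node00.IsRecordOfRecord₁₃CCoPH F N`: module XXXVIII's conclusion with nothing read at a canonical parameter.
* §5 IN RR-2's NAMED CLASSES: `spine_rec13CCoPHOn_of_homes₁₃CoPHOn` (§2 at `Rec := IsRecordOfRecord₁₃CCoPHOn F N Rg`, N27x by XXXVIᶜᵒᴾᴴ `s_N27x_rec13CCoPHOn_of_keyed`; `S_R00x` there is n22-e's
  `s_R00x_rRec₁₃CoPHOn_recordOn` BY NAME, not re-declared) · `spine_rec13CCoPHN_of_homes₁₃CoPHOn` (at the guard of record `Node00.unityNondeg₁₃H N`; ⟺ K3 at `N = 2`, XXXVII-class leaf).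

HONEST FRAMING.  COMPOSITE-node bookkeeping: every K4∕K5 stub, the extraction clause and the edge are HYPOTHESES with NO producer at the Stage-13 record today (0∕1; the children's ₁₃
re-keying is in progress); the readings `cr`, `𝔯`, the regime `Rg` and the record class `Rec` are PARAMETERS; inhabitation of any regime class is K0 `Record13Inhabited`
(stmt-QuantumFields-19909, open) and is NOT used or claimed; nothing of Bałaban's asserted; NE7 ∕ NE7b ∕ NE7c NOT PRINTED for d = 4 and NOT PROVED; NO node discharged; K3 NOT claimed;
counts UNMOVED (typed 28∕28 · discharged 5∕27, A 5∕28); one finite four-torus programme at fixed `ε` — NOT ℝ⁴, NOT infinite volume, NOT OS, NOT a mass gap, NOT Clay.  No decl below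
carries a cite tag.
-/

namespace Summit.QuantumFields.YangMills.Theorems.BalabanUVNodesN27SpineRecord

open Literature.MathematicalPhysics.QuantumFieldTheory.Balaban1983to89
open Literature.MathematicalPhysics.QuantumFieldTheory.Balaban1983to89.T4Continuum
open T4WeightBudget (RelWeightBound)
open T4IndicatorShell (ShellWeightBound)
open T4ContinuumYM4Torus (ForSmallCouplings)
open Summit.QuantumFields.BalabanUV.T4Continuum.Spine
open YMDAG.UVSplit
open Node00 (Stage13HParams datumOfRecord₁₃CoPH IsRecordOfRecord₁₃CCoPH)

variable {N : ℕ} [NeZero N] (cr : SpineReading₁₃CoPH N) (𝔯 : RateReading₁₃CoPH N) (Rg : (F : T4Family) → Stage13HParams F N → Prop)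

/-! ## §0 The regime home on the spine side is a characterised record at the bundled key -/

/-- **(T-SPINE)'s REGIME HOME IS XXIV's CHARACTERISED SPINE RECORD AT THE BUNDLED KEY** `Adm' θ := Rg F θ ∧ θ.Admissible F N` (`sRec₁₃CoPHOn_iff` is `Iff.rfl`; only the two
conjuncts are re-bracketed). [bookkeeping] -/
theorem sRec₁₃CoPHOn_iff_bundled {F : T4Family} (D : Datum F N) (g₀ : ℕ → ℝ) (os : List (ULoop F)) (S : SpineCarriers) :
    SRec₁₃CoPHOn cr Rg F D g₀ os S ↔
      ∃ (θ : Stage13HParams F N) (h : θ.Provisos₁₃CoPH F N), (Rg F θ ∧ θ.Admissible F N) ∧ D = datumOfRecord₁₃CoPH F N θ h ∧ S = cr F θ h g₀ os :=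
  ⟨fun ⟨θ, h, hRg, hθ, hD, hS⟩ => ⟨θ, h, ⟨hRg, hθ⟩, hD, hS⟩, fun ⟨θ, h, hA, hD, hS⟩ => ⟨θ, h, hA.1, hA.2, hD, hS⟩⟩

/-! ## §1 The N19′ edge at the regime-restricted homes with K4's ∀-hook; the ∀-hook from the guarded θ-form of the rates -/

/-- **XII's N19′ EDGE AT `(SRec₁₃CoPHOn cr Rg, Inputs := RateInputsAll (RRec₁₃CoPHOn 𝔯 Rg))` FROM THE SAME-TUPLE, ALL-RUN-LENGTHS, GUARDED EDGE.**  A bundle pinned by the regime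
home at `D` is `cr F θ hP g₀ os` for an admissible θ with provisos IN THE REGIME realising `D`; K4's ∀-hook at `D` gives the six rates at every bundle the rate home pins at `D`, in
particular at every run length `k` of `rateCarriersOfRecord₁₃CoPH 𝔯 F θ hP g₀ os k` — read AT THE SAME θ (`rRec₁₃CoPHOn_self`); so the same-tuple edge `h19` is all XII needs.  No pair of tuples,
no canonical parameter. [bookkeeping] -/
theorem coreEdge_of_homes₁₃CoPHOn
    (h19 : ∀ (F : T4Family) (θ : Stage13HParams F N) (hP : θ.Provisos₁₃CoPH F N), Rg F θ → θ.Admissible F N → ∀ (g₀ : ℕ → ℝ) (os : List (ULoop F)),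
      (∀ k : ℕ, RatesAt (datumOfRecord₁₃CoPH F N θ hP) (rateCarriersOfRecord₁₃CoPH 𝔯 F θ hP g₀ os k)) → letI := (cr F θ hP g₀ os).dec
        ∃ δ : ℕ → ℝ, NE7.Core (cr F θ hP g₀ os).l₀ (cr F θ hP g₀ os).vol (cr F θ hP g₀ os).T (cr F θ hP g₀ os).Bad
          (fun K t τ => (cr F θ hP g₀ os).A K t τ - (cr F θ hP g₀ os).shA K t τ) (fun K t τ => (cr F θ hP g₀ os).B K t τ - (cr F θ hP g₀ os).shB K t τ) δ ∧
          Summable δ)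
    (F : T4Family) (D : Datum F N) (g₀ : ℕ → ℝ) (os : List (ULoop F)) (S : SpineCarriers) (hS : SRec₁₃CoPHOn cr Rg F D g₀ os S)
    (hin : RateInputsAll (RRec₁₃CoPHOn 𝔯 Rg) F D g₀ os) : letI := S.dec
      ∃ δ : ℕ → ℝ, NE7.Core S.l₀ S.vol S.T S.Bad (fun K t τ => S.A K t τ - S.shA K t τ) (fun K t τ => S.B K t τ - S.shB K t τ) δ ∧ Summable δ := by
  obtain ⟨θ, hP, hRg, hθ, rfl, rfl⟩ := hS
  exact h19 F θ hP hRg hθ g₀ os fun k => hin _ (rRec₁₃CoPHOn_self 𝔯 Rg θ hP hRg hθ g₀ os k)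

/-- **K4's ∀-HOOK AT THE REGIME HOME FROM THE GUARDED θ-FORM OF THE SIX RATES** (any record class; thresholds trivial, `ForSmallCouplings.of_forall`): «at every admissible θ with
provisos in the regime, every `g₀`, `os`, `k`, `RatesAt (datumOfRecord₁₃CoPH F N θ hP) (rateCarriersOfRecord₁₃CoPH 𝔯 F θ hP g₀ os k)`» (e.g. n22-e `ratesAt_of_k4_rRec₁₃CoPHOn` from the six stubs)
gives `SpineRates Rec (RateInputsAll (RRec₁₃CoPHOn 𝔯 Rg))`. [bookkeeping] -/
theorem spineRates_rRec₁₃CoPHOn_of_keyedRates (Rec : RecordPred N)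
    (hrates : ∀ (F : T4Family) (θ : Stage13HParams F N) (hP : θ.Provisos₁₃CoPH F N), Rg F θ → θ.Admissible F N → ∀ (g₀ : ℕ → ℝ) (os : List (ULoop F)) (k : ℕ),
      RatesAt (datumOfRecord₁₃CoPH F N θ hP) (rateCarriersOfRecord₁₃CoPH 𝔯 F θ hP g₀ os k)) :
    SpineRates Rec (RateInputsAll (RRec₁₃CoPHOn 𝔯 Rg)) := by
  intro F D w _ _ _
  refine ForSmallCouplings.of_forall fun g₀ os R hR => ?_
  obtain ⟨θ, hP, hRg, hθ, rfl, k, rfl⟩ := hR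
  exact hrates F θ hP hRg hθ g₀ os k

/-! ## §2 The knit at the regime-restricted homes, for any record class -/

/-- **N27 = B5 AT ANY RECORD CLASS FROM THE STUB INSTANCES OF THE TWO REGIME-RESTRICTED CARRIER HOMES AND THE SAME-TUPLE EDGE — `S_R00x` NOT ASKED.**  XII `spine_of_coreEdge` at
`(Rec, SRec₁₃CoPHOn cr Rg, RateInputsAll (RRec₁₃CoPHOn 𝔯 Rg))`: the six K4 stubs at `RRec₁₃CoPHOn 𝔯 Rg` (K4's ∀-hook by `SpineRates_of_forall` — no existence needed), the three K5 stubs at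
`SRec₁₃CoPHOn cr Rg` (`S_N27x` links `Rec` to the regime: at every record of `Rec` the extraction witness is pinned IN the regime) and `h19` (§1) give `Spine Rec`.  Every stub a HYPOTHESIS
(0∕1 today). [bookkeeping] -/
theorem spine_of_homes₁₃CoPHOn (Rec : RecordPred N) (h14 : S_N14 (RRec₁₃CoPHOn 𝔯 Rg)) (h15 : S_N15 (RRec₁₃CoPHOn 𝔯 Rg)) (h16 : S_N16 (RRec₁₃CoPHOn 𝔯 Rg))
    (h17 : S_N17 (RRec₁₃CoPHOn 𝔯 Rg)) (h18 : S_N18 (RRec₁₃CoPHOn 𝔯 Rg)) (h22 : S_N22 (RRec₁₃CoPHOn 𝔯 Rg)) (hx' : S_N27x Rec (SRec₁₃CoPHOn cr Rg))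
    (h20 : S_N20 (SRec₁₃CoPHOn cr Rg)) (h21 : S_N21 (SRec₁₃CoPHOn cr Rg))
    (h19 : ∀ (F : T4Family) (θ : Stage13HParams F N) (hP : θ.Provisos₁₃CoPH F N), Rg F θ → θ.Admissible F N → ∀ (g₀ : ℕ → ℝ) (os : List (ULoop F)),
      (∀ k : ℕ, RatesAt (datumOfRecord₁₃CoPH F N θ hP) (rateCarriersOfRecord₁₃CoPH 𝔯 F θ hP g₀ os k)) → letI := (cr F θ hP g₀ os).dec
        ∃ δ : ℕ → ℝ, NE7.Core (cr F θ hP g₀ os).l₀ (cr F θ hP g₀ os).vol (cr F θ hP g₀ os).T (cr F θ hP g₀ os).Bad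
          (fun K t τ => (cr F θ hP g₀ os).A K t τ - (cr F θ hP g₀ os).shA K t τ) (fun K t τ => (cr F θ hP g₀ os).B K t τ - (cr F θ hP g₀ os).shB K t τ) δ ∧
          Summable δ) :
    Spine Rec :=
  spine_of_coreEdge Rec (SRec₁₃CoPHOn cr Rg) (RateInputsAll (RRec₁₃CoPHOn 𝔯 Rg)) hx' h20 h21 (coreEdge_of_homes₁₃CoPHOn cr 𝔯 Rg h19)
    (SpineRates_of_forall Rec (RRec₁₃CoPHOn 𝔯 Rg) h14 h15 h16 h17 h18 h22)

/-- **THE SAME WITH THE RATES AND THE SPINE-SIDE STUBS IN GUARDED θ-FORM**: the six rates jointly at every run length of the rate reading (`hrates`, §1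
`spineRates_rRec₁₃CoPHOn_of_keyedRates`), N20 `RelWeightBound` ∕ N21 `ShellWeightBound` at `cr F θ hP g₀ os` — each asked ONLY of admissible tuples with provisos IN THE REGIME
((T-SPINE) `s_N20_sRec₁₃CoPHOn_iff`; N21 unfolded here) — `S_N27x Rec (SRec₁₃CoPHOn cr Rg)` and `h19`. [bookkeeping] -/
theorem spine_of_homes₁₃CoPHOn_faces (Rec : RecordPred N)
    (hrates : ∀ (F : T4Family) (θ : Stage13HParams F N) (hP : θ.Provisos₁₃CoPH F N), Rg F θ → θ.Admissible F N → ∀ (g₀ : ℕ → ℝ) (os : List (ULoop F)) (k : ℕ),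
      RatesAt (datumOfRecord₁₃CoPH F N θ hP) (rateCarriersOfRecord₁₃CoPH 𝔯 F θ hP g₀ os k))
    (hx' : S_N27x Rec (SRec₁₃CoPHOn cr Rg))
    (h20 : ∀ (F : T4Family) (θ : Stage13HParams F N) (hP : θ.Provisos₁₃CoPH F N), Rg F θ → θ.Admissible F N → ∀ (g₀ : ℕ → ℝ) (os : List (ULoop F)),
      RelWeightBound (cr F θ hP g₀ os).l₀ (cr F θ hP g₀ os).T (cr F θ hP g₀ os).A (cr F θ hP g₀ os).B (cr F θ hP g₀ os).Bad (cr F θ hP g₀ os).W)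
    (h21 : ∀ (F : T4Family) (θ : Stage13HParams F N) (hP : θ.Provisos₁₃CoPH F N), Rg F θ → θ.Admissible F N → ∀ (g₀ : ℕ → ℝ) (os : List (ULoop F)),
      ShellWeightBound (cr F θ hP g₀ os).l₀ (cr F θ hP g₀ os).T (cr F θ hP g₀ os).A (cr F θ hP g₀ os).B (cr F θ hP g₀ os).shA (cr F θ hP g₀ os).shB
        (cr F θ hP g₀ os).Wsh)
    (h19 : ∀ (F : T4Family) (θ : Stage13HParams F N) (hP : θ.Provisos₁₃CoPH F N), Rg F θ → θ.Admissible F N → ∀ (g₀ : ℕ → ℝ) (os : List (ULoop F)),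
      (∀ k : ℕ, RatesAt (datumOfRecord₁₃CoPH F N θ hP) (rateCarriersOfRecord₁₃CoPH 𝔯 F θ hP g₀ os k)) → letI := (cr F θ hP g₀ os).dec
        ∃ δ : ℕ → ℝ, NE7.Core (cr F θ hP g₀ os).l₀ (cr F θ hP g₀ os).vol (cr F θ hP g₀ os).T (cr F θ hP g₀ os).Bad
          (fun K t τ => (cr F θ hP g₀ os).A K t τ - (cr F θ hP g₀ os).shA K t τ) (fun K t τ => (cr F θ hP g₀ os).B K t τ - (cr F θ hP g₀ os).shB K t τ) δ ∧
          Summable δ) :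
    Spine Rec := by
  refine spine_of_coreEdge Rec (SRec₁₃CoPHOn cr Rg) (RateInputsAll (RRec₁₃CoPHOn 𝔯 Rg)) hx' ((s_N20_sRec₁₃CoPHOn_iff cr Rg).mpr h20) ?_
    (coreEdge_of_homes₁₃CoPHOn cr 𝔯 Rg h19) (spineRates_rRec₁₃CoPHOn_of_keyedRates 𝔯 Rg Rec hrates)
  rintro F D g₀ os S ⟨θ, hP, hRg, hθ, -, rfl⟩
  exact h21 F θ hP hRg hθ g₀ os

/-! ## §3 The regime-keyed datum class and the world-free guarded form «∀ θ h, Rg θ → Adm θ → B5 at the datum» -/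

/-- **N27x AT THE REGIME-KEYED DATUM CLASS FROM THE GUARDED KEYED EXTRACTION CLAUSE** (XXIV `s_N27x_keyed_of` at the bundled key; (K1) is the identity): if at every admissible θ with
provisos IN THE REGIME, under (B) and END at its datum, for all small tuned `g₀` and every `os`, the reading `cr F θ hP g₀ os` has `0 < l₀`, `0 < vol` and satisfies the E1∕E2 dictionary
against the datum's dressed partition functions, then `S_N27x` holds at the class `fun F D _ => ∃ θ h, (Rg F θ ∧ θ.Admissible F N) ∧ D = datumOfRecord₁₃CoPH F N θ h` for `SRec₁₃CoPHOn cr Rg`.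
[bookkeeping] -/
theorem s_N27x_recOn₁₃CoPH_of_keyed
    (hx : ∀ (F : T4Family) (θ : Stage13HParams F N) (hP : θ.Provisos₁₃CoPH F N), Rg F θ → θ.Admissible F N →
      B16.EndStatementBPrinted (datumOfRecord₁₃CoPH F N θ hP).C → DagBinding.EndpointExistence (datumOfRecord₁₃CoPH F N θ hP).C.toB12 →
        ForSmallCouplings (datumOfRecord₁₃CoPH F N θ hP) fun g₀ => ∀ os : List (ULoop F),
          0 < (cr F θ hP g₀ os).l₀ ∧ 0 < (cr F θ hP g₀ os).vol ∧
          (∀ (K : ℕ) (t : ℝ), |t| ≤ (cr F θ hP g₀ os).l₀ →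
            T4GenFunBounds.schemeZ ((datumOfRecord₁₃CoPH F N θ hP).scheme g₀) os ((cr F θ hP g₀ os).K₀ + K) t =
              ∑ τ ∈ (cr F θ hP g₀ os).T K, (cr F θ hP g₀ os).A K t τ) ∧
          (∀ (K : ℕ) (t : ℝ), |t| ≤ (cr F θ hP g₀ os).l₀ →
            T4GenFunBounds.schemeZ ((datumOfRecord₁₃CoPH F N θ hP).scheme g₀) os ((cr F θ hP g₀ os).K₀ + K + 1) t =
              ∑ τ ∈ (cr F θ hP g₀ os).T K, (cr F θ hP g₀ os).B K t τ)) :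
    S_N27x (fun F D _ => ∃ (θ : Stage13HParams F N) (h : θ.Provisos₁₃CoPH F N), (Rg F θ ∧ θ.Admissible F N) ∧ D = datumOfRecord₁₃CoPH F N θ h) (SRec₁₃CoPHOn cr Rg) :=
  s_N27x_keyed_of (Θ := fun F => Stage13HParams F N) (fun θ => θ.Provisos₁₃CoPH _ N) (fun θ => Rg _ θ ∧ θ.Admissible _ N) (fun θ h => datumOfRecord₁₃CoPH _ N θ h) _
    (SRec₁₃CoPHOn cr Rg) (fun θ h => cr _ θ h) (fun _ _ _ hR => hR) (fun _ D g₀ os S => sRec₁₃CoPHOn_iff_bundled cr Rg D g₀ os S)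
    fun F θ hP hA => hx F θ hP hA.1 hA.2

/-- **THE WORLD-FREE GUARDED B5 FROM THE TWO REGIME-RESTRICTED HOMES — THE GUARD REACHES EVERY HYPOTHESIS.**  For any regime `Rg`: the six K4 stubs at `RRec₁₃CoPHOn 𝔯 Rg` (each IS its
node's estimate asked only of admissible tuples IN THE REGIME, read at θ — n22-e `s_N1x_rRec₁₃CoPHOn_iff`), the K5 stubs `S_N20`, `S_N21` at `SRec₁₃CoPHOn cr Rg` (likewise, (T-SPINE) §4), the
guarded keyed extraction clause `hx` and the same-tuple all-run-lengths guarded edge `h19` give «for every admissible Stage-13 θ with provisos IN THE REGIME,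
`HybridNE7Under (datumOfRecord₁₃CoPH F N θ hP) END`» (§2 at the regime-keyed datum class, XXIVb `spine_keyedClass_iff_forall_keyed` at the bundled key).  At `N = 2`,
`Rg F θ := θ.ZhUnity F 2 ∧ θ.SlotsNondegenerate₁₃ F 2`, this is K3 up to its two displayed antecedents (module XXXVII-class leaf).  Every hypothesis 0∕1 today. [bookkeeping] -/
theorem forall_guarded₁₃CoPH_of_homes₁₃CoPHOn (h14 : S_N14 (RRec₁₃CoPHOn 𝔯 Rg)) (h15 : S_N15 (RRec₁₃CoPHOn 𝔯 Rg)) (h16 : S_N16 (RRec₁₃CoPHOn 𝔯 Rg))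
    (h17 : S_N17 (RRec₁₃CoPHOn 𝔯 Rg)) (h18 : S_N18 (RRec₁₃CoPHOn 𝔯 Rg)) (h22 : S_N22 (RRec₁₃CoPHOn 𝔯 Rg)) (h20 : S_N20 (SRec₁₃CoPHOn cr Rg)) (h21 : S_N21 (SRec₁₃CoPHOn cr Rg))
    (hx : ∀ (F : T4Family) (θ : Stage13HParams F N) (hP : θ.Provisos₁₃CoPH F N), Rg F θ → θ.Admissible F N →
      B16.EndStatementBPrinted (datumOfRecord₁₃CoPH F N θ hP).C → DagBinding.EndpointExistence (datumOfRecord₁₃CoPH F N θ hP).C.toB12 →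
        ForSmallCouplings (datumOfRecord₁₃CoPH F N θ hP) fun g₀ => ∀ os : List (ULoop F),
          0 < (cr F θ hP g₀ os).l₀ ∧ 0 < (cr F θ hP g₀ os).vol ∧
          (∀ (K : ℕ) (t : ℝ), |t| ≤ (cr F θ hP g₀ os).l₀ →
            T4GenFunBounds.schemeZ ((datumOfRecord₁₃CoPH F N θ hP).scheme g₀) os ((cr F θ hP g₀ os).K₀ + K) t =
              ∑ τ ∈ (cr F θ hP g₀ os).T K, (cr F θ hP g₀ os).A K t τ) ∧
          (∀ (K : ℕ) (t : ℝ), |t| ≤ (cr F θ hP g₀ os).l₀ →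
            T4GenFunBounds.schemeZ ((datumOfRecord₁₃CoPH F N θ hP).scheme g₀) os ((cr F θ hP g₀ os).K₀ + K + 1) t =
              ∑ τ ∈ (cr F θ hP g₀ os).T K, (cr F θ hP g₀ os).B K t τ))
    (h19 : ∀ (F : T4Family) (θ : Stage13HParams F N) (hP : θ.Provisos₁₃CoPH F N), Rg F θ → θ.Admissible F N → ∀ (g₀ : ℕ → ℝ) (os : List (ULoop F)),
      (∀ k : ℕ, RatesAt (datumOfRecord₁₃CoPH F N θ hP) (rateCarriersOfRecord₁₃CoPH 𝔯 F θ hP g₀ os k)) → letI := (cr F θ hP g₀ os).dec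
        ∃ δ : ℕ → ℝ, NE7.Core (cr F θ hP g₀ os).l₀ (cr F θ hP g₀ os).vol (cr F θ hP g₀ os).T (cr F θ hP g₀ os).Bad
          (fun K t τ => (cr F θ hP g₀ os).A K t τ - (cr F θ hP g₀ os).shA K t τ) (fun K t τ => (cr F θ hP g₀ os).B K t τ - (cr F θ hP g₀ os).shB K t τ) δ ∧
          Summable δ)
    (F : T4Family) (θ : Stage13HParams F N) (hP : θ.Provisos₁₃CoPH F N) (hRg : Rg F θ) (hθ : θ.Admissible F N) :
    T4ApexHybrid.HybridNE7Under (datumOfRecord₁₃CoPH F N θ hP) (DagBinding.EndpointExistence (datumOfRecord₁₃CoPH F N θ hP).C.toB12) :=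
  (spine_keyedClass_iff_forall_keyed (Θ := fun F => Stage13HParams F N) (fun θ => θ.Provisos₁₃CoPH _ N) (fun θ => Rg _ θ ∧ θ.Admissible _ N)
      (fun θ h => datumOfRecord₁₃CoPH _ N θ h)).mp
    (spine_of_homes₁₃CoPHOn cr 𝔯 Rg _ h14 h15 h16 h17 h18 h22 (s_N27x_recOn₁₃CoPH_of_keyed cr Rg hx) h20 h21 h19) F θ hP ⟨hRg, hθ⟩

/-- **THE SAME WITH EVERY STUB IN ITS GUARDED θ-FORM** (§2 `spine_of_homes₁₃CoPHOn_faces` at the regime-keyed datum class): the six rates at every run length of the rate reading, N20 ∕ N21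
at the spine reading, the extraction clause and the edge — all asked ONLY of admissible tuples with provisos in the regime ⇒ B5 at every such tuple's datum. [bookkeeping] -/
theorem forall_guarded₁₃CoPH_of_homes₁₃CoPHOn_faces
    (hrates : ∀ (F : T4Family) (θ : Stage13HParams F N) (hP : θ.Provisos₁₃CoPH F N), Rg F θ → θ.Admissible F N → ∀ (g₀ : ℕ → ℝ) (os : List (ULoop F)) (k : ℕ),
      RatesAt (datumOfRecord₁₃CoPH F N θ hP) (rateCarriersOfRecord₁₃CoPH 𝔯 F θ hP g₀ os k))
    (h20 : ∀ (F : T4Family) (θ : Stage13HParams F N) (hP : θ.Provisos₁₃CoPH F N), Rg F θ → θ.Admissible F N → ∀ (g₀ : ℕ → ℝ) (os : List (ULoop F)),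
      RelWeightBound (cr F θ hP g₀ os).l₀ (cr F θ hP g₀ os).T (cr F θ hP g₀ os).A (cr F θ hP g₀ os).B (cr F θ hP g₀ os).Bad (cr F θ hP g₀ os).W)
    (h21 : ∀ (F : T4Family) (θ : Stage13HParams F N) (hP : θ.Provisos₁₃CoPH F N), Rg F θ → θ.Admissible F N → ∀ (g₀ : ℕ → ℝ) (os : List (ULoop F)),
      ShellWeightBound (cr F θ hP g₀ os).l₀ (cr F θ hP g₀ os).T (cr F θ hP g₀ os).A (cr F θ hP g₀ os).B (cr F θ hP g₀ os).shA (cr F θ hP g₀ os).shB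
        (cr F θ hP g₀ os).Wsh)
    (hx : ∀ (F : T4Family) (θ : Stage13HParams F N) (hP : θ.Provisos₁₃CoPH F N), Rg F θ → θ.Admissible F N →
      B16.EndStatementBPrinted (datumOfRecord₁₃CoPH F N θ hP).C → DagBinding.EndpointExistence (datumOfRecord₁₃CoPH F N θ hP).C.toB12 →
        ForSmallCouplings (datumOfRecord₁₃CoPH F N θ hP) fun g₀ => ∀ os : List (ULoop F),
          0 < (cr F θ hP g₀ os).l₀ ∧ 0 < (cr F θ hP g₀ os).vol ∧
          (∀ (K : ℕ) (t : ℝ), |t| ≤ (cr F θ hP g₀ os).l₀ →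
            T4GenFunBounds.schemeZ ((datumOfRecord₁₃CoPH F N θ hP).scheme g₀) os ((cr F θ hP g₀ os).K₀ + K) t =
              ∑ τ ∈ (cr F θ hP g₀ os).T K, (cr F θ hP g₀ os).A K t τ) ∧
          (∀ (K : ℕ) (t : ℝ), |t| ≤ (cr F θ hP g₀ os).l₀ →
            T4GenFunBounds.schemeZ ((datumOfRecord₁₃CoPH F N θ hP).scheme g₀) os ((cr F θ hP g₀ os).K₀ + K + 1) t =
              ∑ τ ∈ (cr F θ hP g₀ os).T K, (cr F θ hP g₀ os).B K t τ))
    (h19 : ∀ (F : T4Family) (θ : Stage13HParams F N) (hP : θ.Provisos₁₃CoPH F N), Rg F θ → θ.Admissible F N → ∀ (g₀ : ℕ → ℝ) (os : List (ULoop F)),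
      (∀ k : ℕ, RatesAt (datumOfRecord₁₃CoPH F N θ hP) (rateCarriersOfRecord₁₃CoPH 𝔯 F θ hP g₀ os k)) → letI := (cr F θ hP g₀ os).dec
        ∃ δ : ℕ → ℝ, NE7.Core (cr F θ hP g₀ os).l₀ (cr F θ hP g₀ os).vol (cr F θ hP g₀ os).T (cr F θ hP g₀ os).Bad
          (fun K t τ => (cr F θ hP g₀ os).A K t τ - (cr F θ hP g₀ os).shA K t τ) (fun K t τ => (cr F θ hP g₀ os).B K t τ - (cr F θ hP g₀ os).shB K t τ) δ ∧
          Summable δ)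
    (F : T4Family) (θ : Stage13HParams F N) (hP : θ.Provisos₁₃CoPH F N) (hRg : Rg F θ) (hθ : θ.Admissible F N) :
    T4ApexHybrid.HybridNE7Under (datumOfRecord₁₃CoPH F N θ hP) (DagBinding.EndpointExistence (datumOfRecord₁₃CoPH F N θ hP).C.toB12) :=
  (spine_keyedClass_iff_forall_keyed (Θ := fun F => Stage13HParams F N) (fun θ => θ.Provisos₁₃CoPH _ N) (fun θ => Rg _ θ ∧ θ.Admissible _ N)
      (fun θ h => datumOfRecord₁₃CoPH _ N θ h)).mp
    (spine_of_homes₁₃CoPHOn_faces cr 𝔯 Rg _ hrates (s_N27x_recOn₁₃CoPH_of_keyed cr Rg hx) h20 h21 h19) F θ hP ⟨hRg, hθ⟩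

/-! ## §4 The trivial regime at the Stage-13 record class: module XXXVIII's conclusion with nothing read at a canonical parameter -/

/-- **`Spine ₁₃CCoPH` FROM THE TUPLE-KEYED HOMES AT THE TRIVIAL REGIME** (§2 at `Rec := Node00.IsRecordOfRecord₁₃CCoPH F N`, `Rg := ⊤`): module XXXVIII's conclusion, its canonical-key edge
(rates read at `h.params`) replaced by the same-tuple all-run-lengths edge, `S_R00x` not asked.  The six rate stubs at `RRec₁₃CoPHOn 𝔯 ⊤` are STRONGER than XXXVIII's at `RRec₁₃CoPH 𝔯`
(n22-e `k4_rRec₁₃CoPH_of_rRec₁₃CoPHOn_true`), the spine-side ones are the same (`sRec₁₃CoPHOn_true_iff`), the edge is WEAKER. [bookkeeping] -/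
theorem spine_rec13CCoPH_of_homes₁₃CoPHOn_true (h14 : S_N14 (RRec₁₃CoPHOn 𝔯 fun _ _ => True)) (h15 : S_N15 (RRec₁₃CoPHOn 𝔯 fun _ _ => True))
    (h16 : S_N16 (RRec₁₃CoPHOn 𝔯 fun _ _ => True)) (h17 : S_N17 (RRec₁₃CoPHOn 𝔯 fun _ _ => True)) (h18 : S_N18 (RRec₁₃CoPHOn 𝔯 fun _ _ => True))
    (h22 : S_N22 (RRec₁₃CoPHOn 𝔯 fun _ _ => True)) (hx' : S_N27x (fun F D w => IsRecordOfRecord₁₃CCoPH F N D w) (SRec₁₃CoPHOn cr fun _ _ => True))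
    (h20 : S_N20 (SRec₁₃CoPHOn cr fun _ _ => True)) (h21 : S_N21 (SRec₁₃CoPHOn cr fun _ _ => True))
    (h19 : ∀ (F : T4Family) (θ : Stage13HParams F N) (hP : θ.Provisos₁₃CoPH F N), θ.Admissible F N → ∀ (g₀ : ℕ → ℝ) (os : List (ULoop F)),
      (∀ k : ℕ, RatesAt (datumOfRecord₁₃CoPH F N θ hP) (rateCarriersOfRecord₁₃CoPH 𝔯 F θ hP g₀ os k)) → letI := (cr F θ hP g₀ os).dec
        ∃ δ : ℕ → ℝ, NE7.Core (cr F θ hP g₀ os).l₀ (cr F θ hP g₀ os).vol (cr F θ hP g₀ os).T (cr F θ hP g₀ os).Bad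
          (fun K t τ => (cr F θ hP g₀ os).A K t τ - (cr F θ hP g₀ os).shA K t τ) (fun K t τ => (cr F θ hP g₀ os).B K t τ - (cr F θ hP g₀ os).shB K t τ) δ ∧
          Summable δ) :
    Spine (N := N) fun F D w => IsRecordOfRecord₁₃CCoPH F N D w :=
  spine_of_homes₁₃CoPHOn cr 𝔯 (fun _ _ => True) _ h14 h15 h16 h17 h18 h22 hx' h20 h21 fun F θ hP _ hθ => h19 F θ hP hθ

/-! ## §5 N27 at node00-def-RR-2's REGIME RECORD CLASS OF RECORD `Node00.IsRecordOfRecord₁₃CCoPHOn F N Rg` and the CN class `Node00.IsRecordOfRecord₁₃CCoPHN F N` (`Node00/Record13DatumKeyCoPH`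
§§5–7; the home-free faces `spine_rec13CCoPHOn_iff_forall_guarded` ∕ `s_N27x_rec13CCoPHOn_of_keyed` ∕ `spine_rec13CCoPHN_iff_forall_guarded` are module XXXVIᶜᵒᴾᴴ §7) — the knits at the regime homes landing IN the named classes -/

/-- **N27 = B5 AT THE REGIME RECORD CLASS FROM THE STUB INSTANCES OF THE TWO REGIME HOMES, THE GUARDED KEYED EXTRACTION CLAUSE AND THE SAME-TUPLE EDGE** (§2
`spine_of_homes₁₃CoPHOn` at `Rec := IsRecordOfRecord₁₃CCoPHOn F N Rg` with XXXVIᶜᵒᴾᴴ `s_N27x_rec13CCoPHOn_of_keyed` at the key `sRec₁₃CoPHOn_iff_bundled`; `S_R00x` not asked).  Every hypothesis 0∕1 today. [bookkeeping] -/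
theorem spine_rec13CCoPHOn_of_homes₁₃CoPHOn (h14 : S_N14 (RRec₁₃CoPHOn 𝔯 Rg)) (h15 : S_N15 (RRec₁₃CoPHOn 𝔯 Rg)) (h16 : S_N16 (RRec₁₃CoPHOn 𝔯 Rg)) (h17 : S_N17 (RRec₁₃CoPHOn 𝔯 Rg))
    (h18 : S_N18 (RRec₁₃CoPHOn 𝔯 Rg)) (h22 : S_N22 (RRec₁₃CoPHOn 𝔯 Rg)) (h20 : S_N20 (SRec₁₃CoPHOn cr Rg)) (h21 : S_N21 (SRec₁₃CoPHOn cr Rg))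
    (hx : ∀ (F : T4Family) (θ : Stage13HParams F N) (hP : θ.Provisos₁₃CoPH F N), Rg F θ → θ.Admissible F N →
      B16.EndStatementBPrinted (datumOfRecord₁₃CoPH F N θ hP).C → DagBinding.EndpointExistence (datumOfRecord₁₃CoPH F N θ hP).C.toB12 →
        ForSmallCouplings (datumOfRecord₁₃CoPH F N θ hP) fun g₀ => ∀ os : List (ULoop F),
          0 < (cr F θ hP g₀ os).l₀ ∧ 0 < (cr F θ hP g₀ os).vol ∧
          (∀ (K : ℕ) (t : ℝ), |t| ≤ (cr F θ hP g₀ os).l₀ →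
            T4GenFunBounds.schemeZ ((datumOfRecord₁₃CoPH F N θ hP).scheme g₀) os ((cr F θ hP g₀ os).K₀ + K) t =
              ∑ τ ∈ (cr F θ hP g₀ os).T K, (cr F θ hP g₀ os).A K t τ) ∧
          (∀ (K : ℕ) (t : ℝ), |t| ≤ (cr F θ hP g₀ os).l₀ →
            T4GenFunBounds.schemeZ ((datumOfRecord₁₃CoPH F N θ hP).scheme g₀) os ((cr F θ hP g₀ os).K₀ + K + 1) t =
              ∑ τ ∈ (cr F θ hP g₀ os).T K, (cr F θ hP g₀ os).B K t τ))
    (h19 : ∀ (F : T4Family) (θ : Stage13HParams F N) (hP : θ.Provisos₁₃CoPH F N), Rg F θ → θ.Admissible F N → ∀ (g₀ : ℕ → ℝ) (os : List (ULoop F)),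
      (∀ k : ℕ, RatesAt (datumOfRecord₁₃CoPH F N θ hP) (rateCarriersOfRecord₁₃CoPH 𝔯 F θ hP g₀ os k)) → letI := (cr F θ hP g₀ os).dec
        ∃ δ : ℕ → ℝ, NE7.Core (cr F θ hP g₀ os).l₀ (cr F θ hP g₀ os).vol (cr F θ hP g₀ os).T (cr F θ hP g₀ os).Bad
          (fun K t τ => (cr F θ hP g₀ os).A K t τ - (cr F θ hP g₀ os).shA K t τ) (fun K t τ => (cr F θ hP g₀ os).B K t τ - (cr F θ hP g₀ os).shB K t τ) δ ∧
          Summable δ) :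
    Spine (N := N) fun F D w => Node00.IsRecordOfRecord₁₃CCoPHOn F N Rg D w :=
  spine_of_homes₁₃CoPHOn cr 𝔯 Rg _ h14 h15 h16 h17 h18 h22
    (s_N27x_rec13CCoPHOn_of_keyed Rg cr (SRec₁₃CoPHOn cr Rg) (fun _ D g₀ os S => sRec₁₃CoPHOn_iff_bundled cr Rg D g₀ os S) hx) h20 h21 h19

/-- **N27 = B5 AT THE CN RECORD CLASS FROM THE STUBS AT THE GUARD-RESTRICTED HOMES** (`spine_rec13CCoPHOn_of_homes₁₃CoPHOn` at `Rg := Node00.unityNondeg₁₃H N`): the six K4 stubs at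
`RRec₁₃CoPHOn 𝔯 (unityNondeg₁₃H N)`, N20 ∕ N21 at `SRec₁₃CoPHOn cr (unityNondeg₁₃H N)`, the extraction clause and the same-tuple edge — every one asked only of admissible tuples WITH print's
partition of unity and non-degenerate present slots.  Every hypothesis 0∕1 today. [bookkeeping] -/
theorem spine_rec13CCoPHN_of_homes₁₃CoPHOn (h14 : S_N14 (RRec₁₃CoPHOn 𝔯 (Node00.unityNondeg₁₃H N))) (h15 : S_N15 (RRec₁₃CoPHOn 𝔯 (Node00.unityNondeg₁₃H N)))
    (h16 : S_N16 (RRec₁₃CoPHOn 𝔯 (Node00.unityNondeg₁₃H N))) (h17 : S_N17 (RRec₁₃CoPHOn 𝔯 (Node00.unityNondeg₁₃H N))) (h18 : S_N18 (RRec₁₃CoPHOn 𝔯 (Node00.unityNondeg₁₃H N)))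
    (h22 : S_N22 (RRec₁₃CoPHOn 𝔯 (Node00.unityNondeg₁₃H N))) (h20 : S_N20 (SRec₁₃CoPHOn cr (Node00.unityNondeg₁₃H N))) (h21 : S_N21 (SRec₁₃CoPHOn cr (Node00.unityNondeg₁₃H N)))
    (hx : ∀ (F : T4Family) (θ : Stage13HParams F N) (hP : θ.Provisos₁₃CoPH F N), (θ.ZhUnity F N ∧ θ.SlotsNondegenerate₁₃ F N) → θ.Admissible F N →
      B16.EndStatementBPrinted (datumOfRecord₁₃CoPH F N θ hP).C → DagBinding.EndpointExistence (datumOfRecord₁₃CoPH F N θ hP).C.toB12 →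
        ForSmallCouplings (datumOfRecord₁₃CoPH F N θ hP) fun g₀ => ∀ os : List (ULoop F),
          0 < (cr F θ hP g₀ os).l₀ ∧ 0 < (cr F θ hP g₀ os).vol ∧
          (∀ (K : ℕ) (t : ℝ), |t| ≤ (cr F θ hP g₀ os).l₀ →
            T4GenFunBounds.schemeZ ((datumOfRecord₁₃CoPH F N θ hP).scheme g₀) os ((cr F θ hP g₀ os).K₀ + K) t =
              ∑ τ ∈ (cr F θ hP g₀ os).T K, (cr F θ hP g₀ os).A K t τ) ∧
          (∀ (K : ℕ) (t : ℝ), |t| ≤ (cr F θ hP g₀ os).l₀ →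
            T4GenFunBounds.schemeZ ((datumOfRecord₁₃CoPH F N θ hP).scheme g₀) os ((cr F θ hP g₀ os).K₀ + K + 1) t =
              ∑ τ ∈ (cr F θ hP g₀ os).T K, (cr F θ hP g₀ os).B K t τ))
    (h19 : ∀ (F : T4Family) (θ : Stage13HParams F N) (hP : θ.Provisos₁₃CoPH F N), (θ.ZhUnity F N ∧ θ.SlotsNondegenerate₁₃ F N) → θ.Admissible F N →
      ∀ (g₀ : ℕ → ℝ) (os : List (ULoop F)), (∀ k : ℕ, RatesAt (datumOfRecord₁₃CoPH F N θ hP) (rateCarriersOfRecord₁₃CoPH 𝔯 F θ hP g₀ os k)) → letI := (cr F θ hP g₀ os).dec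
        ∃ δ : ℕ → ℝ, NE7.Core (cr F θ hP g₀ os).l₀ (cr F θ hP g₀ os).vol (cr F θ hP g₀ os).T (cr F θ hP g₀ os).Bad
          (fun K t τ => (cr F θ hP g₀ os).A K t τ - (cr F θ hP g₀ os).shA K t τ) (fun K t τ => (cr F θ hP g₀ os).B K t τ - (cr F θ hP g₀ os).shB K t τ) δ ∧
          Summable δ) :
    Spine (N := N) fun F D w => Node00.IsRecordOfRecord₁₃CCoPHN F N D w :=
  spine_rec13CCoPHOn_of_homes₁₃CoPHOn cr 𝔯 (Node00.unityNondeg₁₃H N) h14 h15 h16 h17 h18 h22 h20 h21 hx h19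

end Summit.QuantumFields.YangMills.Theorems.BalabanUVNodesN27SpineRecord
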